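/-
Copyright: pub-rosobs cell (Resolution Observatory), carver gen 47.  Companion file; statements OURS, in
the cell's polynomial weighted-centre model `W(f)`.  Instrument — NOT a resolution theorem.
-/
import Literature.AlgebraicGeometry.Resolution.WeightedCentreBentFamily
import HarnessLib

/-!
# The plain power family `x^q + y3^{q/p} + ℓ^κ`: `max W = (κp, κ(mp+1), κ(mp+1))` for EVERY `κ ≥ 1`

Companion to `WeightedCentreBentFamily` (the bent family `x^q + y3^{q/p} + ℓ^{p^{a−1}} + y2^n ℓ^{p^{a−2}}`,
`max W = (p^a, (mp+1)p^{a−1}, (mp+1)p^{a−1})`, carver gen 45).  Everything is stated in the tree's POLYNOMIAL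
weighted-centre model: `admissibleInvariants f` = the invariants `exps γ` of the centres `(Ψ, γ)` — `Ψ` a
`k`-algebra automorphism of `k[X]` fixing the origin, `γ ≥ 0` rational weights, `v_γ(Ψ⁻¹ f) ≥ 1` (`IsCentreFor`) —
compared in the truncated lexicographic order (`IsMaxInv`).  Instrument; NOT a resolution theorem and NOT a
statement about the invariant of [AbramovichTemkinWlodarczyk2024] on power series.

## The family (variables `(x; y1, y2, y3) = (X 0; X 1, X 2, X 3)`)

For integers `p ≥ 2`, `κ ≥ 1`, `m ≥ 1` and `q = p^{c+1}` with `q/p = p^c > D := κ(mp+1)` (equivalently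
`q > κp(mp+1)`) put `ℓ := y1^p − y2^{mp} y3` (`powLine`) and
* `Φ_κ := ℓ^κ` (`powFace`), `h := y3^{q/p} + ℓ^κ` (`powH`), `F := x^q + h` (`powF`);
* the BENT coordinate change `Ψ : y3 ↦ y3 + x^p` then `y1 ↦ y1 + x y2^m` of `WeightedCentreBentFamily`
  (`bentShear`) and the weights `γ = (0; 1/(κp), 1/D, 1/D)` (`powWeights`; `x` free).

The exponent `κ` is ARBITRARY (not a power of `p`): `ℓ^κ = Σ_{i+j=κ} (−1)^j C(κ,i) y1^{pi} y2^{mpj} y3^j`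
(`powFace_eq_sum`) has `κ+1` monomials with pairwise distinct exponent vectors, all of `(0; mp+1, p, p)`-weight
`p·D`, the two extreme ones `y1^{κp}` and `±y2^{mpκ} y3^κ` with coefficient `±1`.

## Main statements

* `bentShear_symm_powLine`, `bentShear_symm_powF` : in characteristic `p` (prime), `Ψ⁻¹ ℓ = ℓ` and `Ψ⁻¹ F = h`.
* `isCentreFor_pow`, `pow_mem_admissibleInvariants` : `(Ψ, γ)` is a centre for `F`, invariant `(κp, D, D)`;
  `not_isTTight_pow` : it is NOT `T`-tight (the term `x y2^m` of `Ψ⁻¹ y1` has split value `1/q + m/D < 1/(κp)`);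
  `powWeights_one_sub_mul_two`, `powWeights_three_div` : both pins of the centre have rate `1/(p·D) = 1/(κp(mp+1))`,
  and `inv_q_lt_inv_p_mul_powD` : `1/q < 1/(p·D)`.
* `monomialOrd_one_powH`, `homogeneousComponent_powH`, `hironakaDelta_powH`, `deltaInitial_powH`,
  `hironakaTau_powFace` : over EVERY field, `ord h = κp`, `in h = y1^{κp}`, `δ(h; x,y2,y3; y1) = D/(κp) =
  (mp+1)/p ∉ ℕ`, `in_δ h = ℓ^κ`, `τ(ℓ^κ) = 3`.
* `isMaxInv_powH` (every field, every integer `p ≥ 2`), **`isMaxInv_powF`** (characteristic `p`):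
  `max W(F) = max W(h) = (κp, D, D)` — by the `(ν, M, M)` pattern `isMaxInv_triple_of_forall_natCast_ne` of
  `WeightedCentreBentFamily`; `isMaxInv_pow_3_2_1_27` : the smallest instance with `κ ∉ p^ℕ`,
  `x^27 + y3^9 + (y1^3 − y2^3 y3)^2` over fields of characteristic `3`, `max W = (6, 8, 8)`.
* §5, the case `κ = p^s` (`q = p^{s+t+1}`, `p^t > mp+1`): the SPLIT coordinate change `Ψ_T : y1 ↦ y1 + x^{p^t}`
  (`powTightShear`) also carries `F` to `h` (`powTightShear_symm_powF`), is a centre with the same maximal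
  invariant (`isCentreFor_powTight`) and IS `T`-tight (`isTTight_powTight`).

So for every `κ` the maximal invariant of `F` is attained by a NON-`T`-tight centre (the cell's THEOREM F^κ (a),
engine-1 gen 31, in the polynomial model); for `κ = p^s` it is ALSO attained by a `T`-tight one.  NOT typed here:
that for `κ ∉ p^ℕ` NO maximal centre of `F` is `T`-tight (the cell's THEOREM F^κ (b)), and anything in the
power-series model.

## References

[cite: AbramovichTemkinWlodarczyk2024, Rem. 2.4.2 (p. 1568), §5.1 (p. 1575), Lemma 5.2.6 / 5.2.10 (p. 1577), Thm. 5.3.1 (2)–(3) (p. 1578)]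
(the weighted invariant and centre in characteristic zero) ·
[cite: CossartJannsenSaito2020, Def. 1.26 / Lemma 1.27, Def. 8.1–8.2 (pp. 117–118), Def. 8.15 / Thm. 8.16 (p. 121), Thm. 8.22 (a) (p. 124)]
(`δ`, `in_δ`, `τ`, vertex preparation) · [cite: Hauser2010, §C (p. 9), §D (p. 12)] (purely inseparable equations
`x^p + h`, kangaroo phenomena) · [cite: AbramovichQuekSchober2025, Thm. 3.5] (the invariant is a maximum over centres).
-/

noncomputable section

open MvPolynomial

namespace Literature.AlgebraicGeometry.Resolution.WeightedBlowup

variable {k : Type*} [Field k]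

/-! ## §1 The family `F = x^q + h`, `h = y3^{q/p} + ℓ^κ`, `ℓ = y1^p − y2^{mp} y3` -/

section PowFamily

/-- `D = κ(mp+1)`: the repeated entry of the invariant `(κp, D, D)`; `δ = D/(κp) = (mp+1)/p`.
(cell notation `c₂ = c₃`, engine-1 gen 31) [cite: AbramovichTemkinWlodarczyk2024, Thm. 5.3.1 (2) (p. 1578)] -/
def powD (p κ m : ℕ) : ℕ := κ * (m * p + 1)

variable (k) in
/-- `ℓ = y1^p − y2^{mp} y3`. (cell's family, engine-1 gens 28–31) [cite: Hauser2010, §C (p. 9) (the residual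
polynomial of a purely inseparable equation)] -/
def powLine (p m : ℕ) : MvPolynomial (Fin 4) k := X 1 ^ p - X 2 ^ (m * p) * X 3

variable (k) in
/-- The `δ`-face polynomial `Φ_κ = ℓ^κ`. (cell's family, engine-1 gen 31; `deltaInitial_powH`)
[cite: CossartJannsenSaito2020, Def. 8.2 (4) (p. 118) (in_δ)] -/
def powFace (p κ m : ℕ) : MvPolynomial (Fin 4) k := powLine k p m ^ κ

variable (k) in
/-- `h = y3^{q/p} + ℓ^κ` (`q/p = p^c`). (cell's family, engine-1 gen 31) [cite: Hauser2010, §C (p. 9) (the residual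
polynomial `h` of `x^p + h`)] -/
def powH (p κ m c : ℕ) : MvPolynomial (Fin 4) k := X 3 ^ p ^ c + powFace k p κ m

variable (k) in
/-- `F = x^q + h`, `q = p^{c+1}`: a purely inseparable point `x^q + h(y)`. (cell's family, engine-1 gen 31)
[cite: Hauser2010, §C (p. 9) (purely inseparable equations `x^p + h` and the failure of maximal contact)] -/
def powF (p κ m c : ℕ) : MvPolynomial (Fin 4) k := X 0 ^ p ^ (c + 1) + powH k p κ m c

/-- **The cocharacter** `γ = (0; 1/(κp), 1/D, 1/D)` on `(x; y1, y2, y3)`: `x` is a free slot.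
[cite: AbramovichTemkinWlodarczyk2024, §5.1 and Thm. 5.3.1 (2) (p. 1578)] -/
def powWeights (p κ m : ℕ) : Fin 4 → ℚ := umbrellaWeights 1 2 3 (p * κ) (powD p κ m - 1)

/-- The exponent vector of the monomial `y1^{pi} y2^{mpj} y3^{j}` of `ℓ^κ` (`i + j = κ`).
[cite: CossartJannsenSaito2020, Def. 8.1 (p. 117) (exponents `(A, B)` of the monomials `u^A y^B`)] -/
def powExp (p m : ℕ) (ij : ℕ × ℕ) : Fin 4 →₀ ℕ := expFin4 0 (p * ij.1) (m * p * ij.2) ij.2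

variable {p κ m c : ℕ}

/-! ### §1.1 Exponent arithmetic -/

/-- `D ≥ 1` (plumbing). [folklore] -/
private theorem powD_pos₄₇ (hκ : 1 ≤ κ) (p m : ℕ) : 0 < powD p κ m := by
  unfold powD; positivity

/-- `D − 1 + 1 = D` (plumbing). [folklore] -/
private theorem powD_sub_add₄₇ (hκ : 1 ≤ κ) (p m : ℕ) : powD p κ m - 1 + 1 = powD p κ m :=
  Nat.sub_add_cancel (powD_pos₄₇ hκ p m)

/-- `κp < D` when `m ≥ 1` (plumbing). [folklore] -/
private theorem nu_lt_powD₄₇ (p : ℕ) (hκ : 1 ≤ κ) (hm : 1 ≤ m) : p * κ < powD p κ m := by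
  unfold powD
  have h1 : p * κ < p * κ + κ := Nat.lt_add_of_pos_right hκ
  have h2 : p * κ ≤ m * (p * κ) := Nat.le_mul_of_pos_left _ hm
  calc p * κ < p * κ + κ := h1
    _ ≤ m * (p * κ) + κ := by omega
    _ = κ * (m * p + 1) := by ring

/-- `p·D = (mp+1)·κp` (plumbing). [folklore] -/
private theorem p_mul_powD₄₇ (p κ m : ℕ) : p * powD p κ m = (m * p + 1) * (p * κ) := by
  unfold powD; ring

/-- `δ = D/(κp) = (mp+1)/p` is not an integer when `p ≥ 2` (plumbing). [folklore] -/
private theorem natCast_ne_powDelta₄₇ (hp : 2 ≤ p) (hκ : 1 ≤ κ) (m q : ℕ) :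
    (q : ℚ) ≠ ((powD p κ m : ℕ) : ℚ) / ((p * κ : ℕ) : ℚ) := by
  intro h
  have hν : ((p * κ : ℕ) : ℚ) ≠ 0 := by positivity
  rw [eq_div_iff hν] at h
  have h' : q * (p * κ) = powD p κ m := by exact_mod_cast h
  have h2 : q * p = m * p + 1 := by
    have h3 : q * p * κ = (m * p + 1) * κ := by rw [mul_assoc, h', powD]; ring
    exact Nat.eq_of_mul_eq_mul_right hκ h3
  have h3 : p ∣ 1 := (Nat.dvd_add_right (dvd_mul_left p m)).1 (h2 ▸ dvd_mul_left p q)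
  have := Nat.le_of_dvd one_pos h3
  omega

/-- Values of the integer weights `w = (0; mp+1, p, p)` (plumbing). [folklore] -/
private theorem bentW_apply₄₇ (p m : ℕ) :
    bentW p m 0 = 0 ∧ bentW p m 1 = m * p + 1 ∧ bentW p m 2 = p ∧ bentW p m 3 = p := by
  simp [bentW]

/-- The monomials of `ℓ^κ` all have `(0; mp+1, p, p)`-weight `p·D` (plumbing). [folklore] -/
private theorem weight_powExp₄₇ {i j : ℕ} (h : i + j = κ) :
    Finsupp.weight (bentW p m) (powExp p m (i, j)) = p * powD p κ m := by
  obtain ⟨h0, h1, h2, h3⟩ := bentW_apply₄₇ p m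
  simp only [powExp, weight_expFin4, h0, h1, h2, h3]
  rw [← h, powD]
  ring

/-- `y3^{q/p}` is none of the monomials of `ℓ^κ` (plumbing). [folklore] -/
private theorem X3pow_ne_powExp₄₇ (hp : 1 ≤ p) (hm : 1 ≤ m) (c : ℕ) (ij : ℕ × ℕ) :
    expFin4 0 0 0 (p ^ c) ≠ powExp p m ij := by
  intro he
  unfold powExp at he
  obtain ⟨-, -, h2, h3⟩ := expFin4_eq_iff.1 he
  have hj : 0 < m * p * ij.2 := Nat.mul_pos (Nat.mul_pos hm hp) (h3 ▸ pow_pos hp c)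
  omega

/-! ### §1.2 The `κ + 1` monomials of `ℓ^κ` and the `κ + 2` of `h` -/

/-- **Binomial expansion of the face**: `ℓ^κ = Σ_{i+j=κ} (−1)^j·C(κ,i)·y1^{pi} y2^{mpj} y3^{j}`. (derived here)
[cite: CossartJannsenSaito2020, Def. 8.2 (4) (p. 118)] -/
theorem powFace_eq_sum (p κ m : ℕ) : powFace k p κ m =
    ∑ ij ∈ Finset.antidiagonal κ, monomial (powExp p m ij) ((-1) ^ ij.2 * (κ.choose ij.1 : k)) := by
  rw [powFace, powLine, sub_eq_add_neg, (Commute.all _ _).add_pow']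
  refine Finset.sum_congr rfl ?_
  rintro ⟨i, j⟩ -
  have hmon : (monomial (powExp p m (i, j)) ((-1) ^ j * (κ.choose i : k)) : MvPolynomial (Fin 4) k) =
      C ((-1) ^ j * (κ.choose i : k)) * monomial (powExp p m (i, j)) 1 := by
    rw [C_mul_monomial, mul_one]
  rw [hmon, powExp, monomial_expFin4, neg_pow (X 2 ^ (m * p) * X 3 : MvPolynomial (Fin 4) k)]
  simp only [nsmul_eq_mul, mul_pow, ← pow_mul, pow_zero, one_mul, map_mul, map_pow, map_neg, map_one, map_natCast]
  ring

/-- **Coefficients of `ℓ^κ`.** (derived here) [cite: CossartJannsenSaito2020, Def. 8.2 (p. 118)] -/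
theorem coeff_powFace (p κ m : ℕ) (d : Fin 4 →₀ ℕ) : coeff d (powFace k p κ m) =
    ∑ ij ∈ Finset.antidiagonal κ, if powExp p m ij = d then (-1) ^ ij.2 * (κ.choose ij.1 : k) else 0 := by
  classical
  rw [powFace_eq_sum, coeff_sum]
  exact Finset.sum_congr rfl fun ij _ => coeff_monomial _ _ _

/-- **The support of `ℓ^κ`** lies in its `κ + 1` exponent vectors. (derived here)
[cite: CossartJannsenSaito2020, Def. 8.2 (p. 118)] -/
theorem support_powFace_subset (p κ m : ℕ) :
    (powFace k p κ m).support ⊆ (Finset.antidiagonal κ).image (powExp p m) := by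
  classical
  intro d hd
  rw [powFace_eq_sum] at hd
  obtain ⟨ij, hij, hd'⟩ := Finset.mem_biUnion.1 (support_sum hd)
  exact Finset.mem_image.2 ⟨ij, hij, (Finset.mem_singleton.1 (support_monomial_subset hd')).symm⟩

/-- The `κ + 1` exponent vectors of `ℓ^κ` are pairwise distinct (their `y3`-exponents are `j = 0, …, κ`).
(derived here) [cite: CossartJannsenSaito2020, Def. 8.1 (p. 117)] -/
theorem powExp_injOn {ij ij' : ℕ × ℕ} (h : ij ∈ Finset.antidiagonal κ) (h' : ij' ∈ Finset.antidiagonal κ)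
    (he : powExp p m ij = powExp p m ij') : ij = ij' := by
  rw [Finset.mem_antidiagonal] at h h'
  unfold powExp at he
  have h3 : ij.2 = ij'.2 := (expFin4_eq_iff.1 he).2.2.2
  exact Prod.ext (by omega) h3

/-- **The coefficient of `y1^{pi} y2^{mpj} y3^{j}` in `ℓ^κ` is `(−1)^j C(κ,i)`.** (derived here)
[cite: CossartJannsenSaito2020, Def. 8.2 (p. 118)] -/
theorem coeff_powExp_powFace {ij : ℕ × ℕ} (hij : ij ∈ Finset.antidiagonal κ) :
    coeff (powExp p m ij) (powFace k p κ m) = (-1) ^ ij.2 * (κ.choose ij.1 : k) := by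
  classical
  rw [coeff_powFace, Finset.sum_eq_single ij]
  · rw [if_pos rfl]
  · intro ij' hij' hne
    exact if_neg fun h => hne (powExp_injOn hij' hij h)
  · intro h
    exact absurd hij h

/-- The coefficient of `y1^{κp}` in `ℓ^κ` is `1`. (derived here) [cite: CossartJannsenSaito2020, Def. 8.2 (p. 118)] -/
theorem coeff_top_powFace (p κ m : ℕ) : coeff (expFin4 0 (p * κ) 0 0) (powFace k p κ m) = 1 := by
  have h := coeff_powExp_powFace (k := k) (p := p) (κ := κ) (m := m) (ij := (κ, 0)) (by simp)
  simp only [powExp, mul_zero, pow_zero, one_mul, Nat.choose_self, Nat.cast_one] at h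
  exact h

/-- The coefficient of `y2^{mpκ} y3^{κ}` in `ℓ^κ` is `(−1)^κ`. (derived here) [cite: CossartJannsenSaito2020, Def. 8.2 (p. 118)] -/
theorem coeff_bottom_powFace (p κ m : ℕ) :
    coeff (expFin4 0 0 (m * p * κ) κ) (powFace k p κ m) = (-1) ^ κ := by
  have h := coeff_powExp_powFace (k := k) (p := p) (κ := κ) (m := m) (ij := (0, κ)) (by simp)
  simp only [powExp, mul_zero, Nat.choose_zero_right, Nat.cast_one, mul_one] at h
  exact h

/-- `y3^e` as a monomial (plumbing). [folklore] -/
private theorem X3_pow_eq₄₇ (e : ℕ) : (X 3 ^ e : MvPolynomial (Fin 4) k) = monomial (expFin4 0 0 0 e) 1 := by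
  rw [monomial_expFin4]; simp

/-- **Coefficients of `h`.** (derived here) [cite: CossartJannsenSaito2020, Def. 8.2 (p. 118)] -/
theorem coeff_powH (p κ m c : ℕ) (d : Fin 4 →₀ ℕ) : coeff d (powH k p κ m c) =
    (if expFin4 0 0 0 (p ^ c) = d then 1 else 0) + coeff d (powFace k p κ m) := by
  classical
  rw [powH, coeff_add, X3_pow_eq₄₇, coeff_monomial]

/-- **The support of `h`** lies in `y3^{q/p}` and the `κ + 1` monomials of `ℓ^κ`. (derived here)
[cite: CossartJannsenSaito2020, Def. 8.2 (p. 118)] -/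
theorem support_powH_subset (p κ m c : ℕ) : (powH k p κ m c).support ⊆
    insert (expFin4 0 0 0 (p ^ c)) ((Finset.antidiagonal κ).image (powExp p m)) := by
  classical
  intro d hd
  rw [powH, X3_pow_eq₄₇] at hd
  rcases Finset.mem_union.1 (support_add hd) with h | h
  · exact Finset.mem_insert.2 (Or.inl (Finset.mem_singleton.1 (support_monomial_subset h)))
  · exact Finset.mem_insert_of_mem (support_powFace_subset p κ m h)

/-- `y3^{q/p}` has coefficient `0` in `ℓ^κ` (plumbing). [folklore] -/
private theorem coeff_X3pow_powFace₄₇ (hp : 1 ≤ p) (hm : 1 ≤ m) (κ c : ℕ) :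
    coeff (expFin4 0 0 0 (p ^ c)) (powFace k p κ m) = 0 := by
  classical
  by_contra hne
  obtain ⟨ij, -, he⟩ := Finset.mem_image.1 (support_powFace_subset p κ m (mem_support_iff.2 hne))
  exact X3pow_ne_powExp₄₇ hp hm c ij he.symm

/-! ### §1.3 The bent coordinate change carries `F` to `h` (characteristic `p`) -/

/-- **`ℓ` is invariant**: `Ψ⁻¹ ℓ = ℓ(y1 − x y2^m, y2, y3 − x^p) = ℓ` in characteristic `p` — the `𝔾_a`-symmetry
`σ_x` of `ℓ = y1^p − y2^{mp} y3`. (derived here; the cell's LEMMA behind THEOREM F^κ)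
[cite: Hauser2010, §D (p. 12) (coordinate changes mixing `x` into `y`)] [cite: CossartJannsenSaito2020, Thm. 8.16 (p. 121)] -/
theorem bentShear_symm_powLine [hp : Fact p.Prime] [CharP k p] (m : ℕ) :
    (bentShear k p m).symm (powLine k p m) = powLine k p m := by
  simp only [powLine, map_sub, map_mul, map_pow, bentShear_symm_X_one, bentShear_symm_X_two,
    bentShear_symm_X_three]
  rw [sub_pow_char (p := p), mul_pow, ← pow_mul]
  ring

/-- **`F` in the bent coordinates is `h`**: `Ψ⁻¹(x^q + y3^{q/p} + ℓ^κ) = y3^{q/p} + ℓ^κ`, since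
`(y3 − x^p)^{q/p} = y3^{q/p} − x^q` cancels `x^q` and `ℓ` is `Ψ`-invariant — for EVERY exponent `κ`.
(derived here; the cell's THEOREM F^κ (a) identity) [cite: CossartJannsenSaito2020, Thm. 8.16 (p. 121)]
[cite: Hauser2010, §D (p. 12) (kangaroo phenomenon)] -/
theorem bentShear_symm_powF [hp : Fact p.Prime] [CharP k p] (κ m c : ℕ) :
    (bentShear k p m).symm (powF k p κ m c) = powH k p κ m c := by
  simp only [powF, powH, powFace, map_add, map_pow, bentShear_symm_powLine, bentShear_symm_X_zero,
    bentShear_symm_X_three]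
  rw [sub_pow_char_pow (p := p), ← pow_mul, ← pow_succ']
  ring

/-- Hence `F = Ψ(h)` and **`W(F) = W(h)`**. (derived here)
[cite: AbramovichTemkinWlodarczyk2024, Thm. 5.3.1 (3) (p. 1578) (independence of coordinates)] -/
theorem admissibleInvariants_powF [hp : Fact p.Prime] [CharP k p] (κ m c : ℕ) :
    admissibleInvariants (powF k p κ m c) = admissibleInvariants (powH k p κ m c) := by
  have h : powF k p κ m c = bentShear k p m (powH k p κ m c) := by
    rw [← bentShear_symm_powF, AlgEquiv.apply_symm_apply]
  rw [h, admissibleInvariants_map_eq _ (constantCoeff_bentShear_X hp.out.one_lt.le m)]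

/-! ### §1.4 The weights: `exps γ = (κp, D, D)`, admissibility of `h` -/

/-- The cocharacter unfolded (plumbing). [cite: AbramovichTemkinWlodarczyk2024, §5.1] -/
theorem powWeights_apply (p κ m : ℕ) (x : Fin 4) : powWeights p κ m x =
    if x = 1 then (((p * κ : ℕ) : ℚ))⁻¹ else if x = 2 ∨ x = 3 then (((powD p κ m - 1 + 1 : ℕ) : ℚ))⁻¹ else 0 :=
  rfl

/-- `γ(x) = 0`: `x` is a free slot. [cite: AbramovichTemkinWlodarczyk2024, §5.1] -/
theorem powWeights_zero (p κ m : ℕ) : powWeights p κ m 0 = 0 := by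
  rw [powWeights_apply, if_neg (by decide), if_neg (by decide)]

/-- `γ(y1) = 1/(κp)`. [cite: AbramovichTemkinWlodarczyk2024, §5.1] -/
theorem powWeights_one (p κ m : ℕ) : powWeights p κ m 1 = (((p * κ : ℕ) : ℚ))⁻¹ := by
  rw [powWeights_apply, if_pos rfl]

/-- `γ(y2) = 1/D`. [cite: AbramovichTemkinWlodarczyk2024, §5.1] -/
theorem powWeights_two (hκ : 1 ≤ κ) (p m : ℕ) : powWeights p κ m 2 = (((powD p κ m : ℕ) : ℚ))⁻¹ := by
  rw [powWeights_apply, if_neg (by decide), if_pos (Or.inl rfl), powD_sub_add₄₇ hκ]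

/-- `γ(y3) = 1/D`. [cite: AbramovichTemkinWlodarczyk2024, §5.1] -/
theorem powWeights_three (hκ : 1 ≤ κ) (p m : ℕ) : powWeights p κ m 3 = (((powD p κ m : ℕ) : ℚ))⁻¹ := by
  rw [powWeights_apply, if_neg (by decide), if_pos (Or.inr rfl), powD_sub_add₄₇ hκ]

/-- `γ ≥ 0`. [cite: AbramovichTemkinWlodarczyk2024, §5.1] -/
theorem powWeights_nonneg (p κ m : ℕ) (x : Fin 4) : 0 ≤ powWeights p κ m x := by
  rw [powWeights_apply]
  split_ifs <;> positivity

/-- **`exps γ = (κp, D, D)`.** (derived here) [cite: AbramovichTemkinWlodarczyk2024, Thm. 5.3.1 (2) (p. 1578)] -/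
theorem exps_powWeights (hp : 1 ≤ p) (hκ : 1 ≤ κ) (hm : 1 ≤ m) :
    exps (powWeights p κ m) = [((p * κ : ℕ) : ℚ), ((powD p κ m : ℕ) : ℚ), ((powD p κ m : ℕ) : ℚ)] := by
  rw [powWeights, exps_umbrellaWeights (by decide) (by decide) (by decide) (Nat.mul_pos hp hκ)
    (by rw [powD_sub_add₄₇ hκ]; exact (nu_lt_powD₄₇ p hκ hm).le), powD_sub_add₄₇ hκ]

/-- `w = p·D·γ` for the integer weights `w = (0; mp+1, p, p)` (plumbing).
[cite: AbramovichTemkinWlodarczyk2024, Rem. 2.4.2 (p. 1568)] -/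
private theorem bentW_eq_mul_powWeights₄₇ (hp : 1 ≤ p) (hκ : 1 ≤ κ) (m : ℕ) (i : Fin 4) :
    ((bentW p m i : ℕ) : ℚ) = ((p * powD p κ m : ℕ) : ℚ) * powWeights p κ m i := by
  obtain ⟨h0, h1, h2, h3⟩ := bentW_apply₄₇ p m
  have hD : ((powD p κ m : ℕ) : ℚ) ≠ 0 := by
    have := powD_pos₄₇ hκ p m
    positivity
  have hν : ((p * κ : ℕ) : ℚ) ≠ 0 := by
    have := Nat.mul_pos hp hκ
    positivity
  have e1 : ((p * powD p κ m : ℕ) : ℚ) = ((m * p + 1 : ℕ) : ℚ) * ((p * κ : ℕ) : ℚ) := by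
    rw [p_mul_powD₄₇, Nat.cast_mul]
  have e2 : ((p * powD p κ m : ℕ) : ℚ) = (p : ℚ) * ((powD p κ m : ℕ) : ℚ) := Nat.cast_mul _ _
  fin_cases i
  · simp [h0, powWeights_zero]
  · simp only [Fin.mk_one, Fin.isValue, h1, powWeights_one]
    rw [e1, mul_inv_cancel_right₀ hν]
  · simp only [Fin.reduceFinMk, h2, powWeights_two hκ]
    rw [e2, mul_inv_cancel_right₀ hD]
  · simp only [Fin.reduceFinMk, h3, powWeights_three hκ]
    rw [e2, mul_inv_cancel_right₀ hD]

/-- **`γ` is admissible for `h`**: for `w = (0; mp+1, p, p)` the monomials of `ℓ^κ` have `w`-weight exactly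
`p·D` and `y3^{q/p}` has `w`-weight `p·q/p ≥ p·D`. (derived here)
[cite: AbramovichTemkinWlodarczyk2024, Thm. 5.3.1 (2) (p. 1578), Lemma 5.2.6 (p. 1577)] -/
theorem isAdmissibleFor_powH (hp : 1 ≤ p) (hκ : 1 ≤ κ) (hq : powD p κ m < p ^ c) :
    IsAdmissibleFor (powWeights p κ m) (powH k p κ m c) := by
  classical
  have hD := powD_pos₄₇ hκ p m
  obtain ⟨h0, h1, h2, h3⟩ := bentW_apply₄₇ p m
  rw [isAdmissibleFor_iff_le_monomialOrd _ (bentW p m) (N := p * powD p κ m) (Nat.mul_pos hp hD)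
    (bentW_eq_mul_powWeights₄₇ hp hκ m), le_monomialOrd_iff]
  intro d hd
  rcases Finset.mem_insert.1 (support_powH_subset p κ m c hd) with rfl | h
  · rw [weight_expFin4, h0, h1, h2, h3]
    calc p * powD p κ m ≤ p * p ^ c := Nat.mul_le_mul_left p hq.le
      _ = _ := by ring
  · obtain ⟨⟨i, j⟩, hij, rfl⟩ := Finset.mem_image.1 h
    simp only [Finset.mem_antidiagonal] at hij
    exact (weight_powExp₄₇ hij).ge

variable (k) in
/-- **The bent centre `(Ψ, γ)` is a centre for `F = x^q + y3^{q/p} + ℓ^κ`** (the cell's THEOREM F^κ (a), typed;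
centre `(y1 + x y2^m, y2, y3 + x^p; 1/(κp), 1/D, 1/D)`): origin fixed, `γ ≥ 0`, `Ψ⁻¹ F = h` has `v_γ ≥ 1`.
It is non-split: `x` is mixed into `y1, y3`. (derived here) [cite: AbramovichTemkinWlodarczyk2024, Thm. 5.3.1 (2) (p. 1578)]
[cite: Hauser2010, §C (p. 9), §D (p. 12)] -/
theorem isCentreFor_pow [hp : Fact p.Prime] [CharP k p] (hκ : 1 ≤ κ) (hq : κ * (m * p + 1) < p ^ c) :
    IsCentreFor (powF k p κ m c) (bentShear k p m) (powWeights p κ m) := by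
  refine ⟨constantCoeff_bentShear_X hp.out.one_lt.le m, powWeights_nonneg p κ m, ?_⟩
  rw [bentShear_symm_powF]
  exact isAdmissibleFor_powH hp.out.one_lt.le hκ hq

/-- **The identity centre `(id, γ)` is a centre for `h`** — in every characteristic, `p ≥ 1` any integer.
(derived here) [cite: AbramovichTemkinWlodarczyk2024, Thm. 5.3.1 (2) (p. 1578)] -/
theorem isCentreFor_powH_refl (hp : 1 ≤ p) (hκ : 1 ≤ κ) (hq : powD p κ m < p ^ c) :
    IsCentreFor (powH k p κ m c) AlgEquiv.refl (powWeights p κ m) := by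
  refine ⟨fun i => by simp, powWeights_nonneg p κ m, ?_⟩
  rw [AlgEquiv.refl_symm, AlgEquiv.coe_refl, id]
  exact isAdmissibleFor_powH hp hκ hq

/-- **`(κp, D, D) ∈ W(h)`** over every field. (derived here) [cite: AbramovichTemkinWlodarczyk2024, Thm. 5.3.1 (2)] -/
theorem powH_mem_admissibleInvariants (hp : 1 ≤ p) (hκ : 1 ≤ κ) (hm : 1 ≤ m) (hq : powD p κ m < p ^ c) :
    [((p * κ : ℕ) : ℚ), ((powD p κ m : ℕ) : ℚ), ((powD p κ m : ℕ) : ℚ)] ∈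
      admissibleInvariants (powH k p κ m c) := by
  rw [← exps_powWeights hp hκ hm]
  exact exps_mem_admissibleInvariants (isCentreFor_powH_refl hp hκ hq)

/-- **`(κp, D, D) ∈ W(F)`** in characteristic `p`, via the bent centre. (derived here; the cell's THEOREM F^κ (a))
[cite: AbramovichTemkinWlodarczyk2024, Thm. 5.3.1 (2) (p. 1578)] [cite: Hauser2010, §C (p. 9)] -/
theorem pow_mem_admissibleInvariants [hp : Fact p.Prime] [CharP k p] (hκ : 1 ≤ κ) (hm : 1 ≤ m)
    (hq : κ * (m * p + 1) < p ^ c) :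
    [((p * κ : ℕ) : ℚ), ((κ * (m * p + 1) : ℕ) : ℚ), ((κ * (m * p + 1) : ℕ) : ℚ)] ∈
      admissibleInvariants (powF k p κ m c) := by
  show [((p * κ : ℕ) : ℚ), ((powD p κ m : ℕ) : ℚ), ((powD p κ m : ℕ) : ℚ)] ∈ _
  rw [← exps_powWeights hp.out.one_lt.le hκ hm]
  exact exps_mem_admissibleInvariants (isCentreFor_pow k hκ hq)

/-! ### §1.5 The bent centre is not `T`-tight; its rate is `1/(κp(mp+1)) > 1/q` -/

/-- **The bent centre of `F` is not `T`-tight**: the term `x·y2^m` of `Ψ⁻¹(y1) = y1 − x y2^m` has split value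
`1/q + m/D < 1/(κp) = γ(y1)` — equivalently `q > κp(mp+1)`. (derived here; the cell's THEOREM F^κ (a),
`θ(Z) > 1/q`) [cite: Hauser2010, §D (p. 12)] [cite: CossartJannsenSaito2020, Thm. 8.16 (p. 121)] -/
theorem not_isTTight_pow (hp : 2 ≤ p) (hκ : 1 ≤ κ) (hq : κ * (m * p + 1) < p ^ c) :
    ¬ IsTTight (p ^ (c + 1)) 0 (bentShear k p m) (powWeights p κ m) := by
  classical
  have hp1 : 1 ≤ p := by omega
  intro h
  have hmon : (X 0 * X 2 ^ m : MvPolynomial (Fin 4) k) = monomial (expFin4 1 0 m 0) 1 := by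
    rw [monomial_expFin4]; simp
  have hX1 : (X 1 : MvPolynomial (Fin 4) k) = monomial (expFin4 0 1 0 0) 1 := by
    rw [monomial_expFin4]; simp
  have hmem : expFin4 1 0 m 0 ∈ ((bentShear k p m).symm (X 1)).support := by
    rw [bentShear_symm_X_one, hmon, hX1, mem_support_iff, coeff_sub, coeff_monomial, coeff_monomial, if_neg,
      if_pos rfl]
    · norm_num
    · rw [expFin4_eq_iff]; omega
  have hle := h 1 _ hmem (by simp)
  rw [monomialValuation_expFin4] at hle
  simp only [Function.update_self, Function.update_of_ne (show (1 : Fin 4) ≠ 0 by decide),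
    Function.update_of_ne (show (2 : Fin 4) ≠ 0 by decide), Function.update_of_ne (show (3 : Fin 4) ≠ 0 by decide),
    powWeights_one, powWeights_two hκ, Nat.cast_zero, Nat.cast_one, zero_mul, add_zero, one_mul] at hle
  -- `hle : 1/(κp) ≤ 1/q + m/D`; but `q > κp(mp+1)` says the opposite
  have hD : (0 : ℚ) < ((powD p κ m : ℕ) : ℚ) := by exact_mod_cast powD_pos₄₇ hκ p m
  have hν : (0 : ℚ) < ((p * κ : ℕ) : ℚ) := by exact_mod_cast Nat.mul_pos hp1 hκ
  have hq' : (0 : ℚ) < ((p ^ (c + 1) : ℕ) : ℚ) := by positivity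
  have key : ((powD p κ m : ℕ) : ℚ) * ((p * κ : ℕ) : ℚ) + (m : ℚ) * ((p ^ (c + 1) : ℕ) : ℚ) * ((p * κ : ℕ) : ℚ)
      < ((p ^ (c + 1) : ℕ) : ℚ) * ((powD p κ m : ℕ) : ℚ) := by
    have h1 : powD p κ m * (p * κ) + m * p ^ (c + 1) * (p * κ) < p ^ (c + 1) * powD p κ m := by
      have e : p ^ (c + 1) * powD p κ m = m * p ^ (c + 1) * (p * κ) + p ^ c * (p * κ) := by
        unfold powD; ring
      rw [e]
      have h2 : powD p κ m * (p * κ) < p ^ c * (p * κ) := Nat.mul_lt_mul_of_pos_right hq (Nat.mul_pos hp1 hκ)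
      omega
    exact_mod_cast h1
  have h1 : ((p ^ (c + 1) : ℕ) : ℚ) * ((powD p κ m : ℕ) : ℚ) * ((p * κ : ℕ) : ℚ) * (((p * κ : ℕ) : ℚ))⁻¹
      = ((p ^ (c + 1) : ℕ) : ℚ) * ((powD p κ m : ℕ) : ℚ) := mul_inv_cancel_right₀ hν.ne' _
  have h2 : ((p ^ (c + 1) : ℕ) : ℚ) * ((powD p κ m : ℕ) : ℚ) * ((p * κ : ℕ) : ℚ) *
      (1 / ((p ^ (c + 1) : ℕ) : ℚ) + (m : ℚ) * (((powD p κ m : ℕ) : ℚ))⁻¹)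
      = ((powD p κ m : ℕ) : ℚ) * ((p * κ : ℕ) : ℚ) +
        (m : ℚ) * ((p ^ (c + 1) : ℕ) : ℚ) * ((p * κ : ℕ) : ℚ) := by
    rw [mul_add, show ((p ^ (c + 1) : ℕ) : ℚ) * ((powD p κ m : ℕ) : ℚ) * ((p * κ : ℕ) : ℚ) *
        (1 / ((p ^ (c + 1) : ℕ) : ℚ)) = ((powD p κ m : ℕ) : ℚ) * ((p * κ : ℕ) : ℚ) *
          (((p ^ (c + 1) : ℕ) : ℚ) * (1 / ((p ^ (c + 1) : ℕ) : ℚ))) by ring,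
      mul_one_div_cancel hq'.ne', mul_one,
      show ((p ^ (c + 1) : ℕ) : ℚ) * ((powD p κ m : ℕ) : ℚ) * ((p * κ : ℕ) : ℚ) *
        ((m : ℚ) * (((powD p κ m : ℕ) : ℚ))⁻¹) = (m : ℚ) * ((p ^ (c + 1) : ℕ) : ℚ) * ((p * κ : ℕ) : ℚ) *
          (((powD p κ m : ℕ) : ℚ) * (((powD p κ m : ℕ) : ℚ))⁻¹) by ring,
      mul_inv_cancel₀ hD.ne', mul_one]
  have hle' := mul_le_mul_of_nonneg_left hle (le_of_lt (mul_pos (mul_pos hq' hD) hν))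
  rw [h1, h2] at hle'
  linarith

/-- **The rate of the pin `y1 + x·y2^m`**: `(γ(y1) − m·γ(y2))/1 = 1/(κp) − m/D = 1/(p·D) = 1/(κp(mp+1))`.
(derived here; the cell's `θ(Z) = θ_κ`) [cite: AbramovichTemkinWlodarczyk2024, §5.1 (weights of a centre)] -/
theorem powWeights_one_sub_mul_two (hp : 1 ≤ p) (hκ : 1 ≤ κ) (m : ℕ) :
    powWeights p κ m 1 - m * powWeights p κ m 2 = (((p * powD p κ m : ℕ) : ℚ))⁻¹ := by
  have hD : ((powD p κ m : ℕ) : ℚ) ≠ 0 := by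
    have := powD_pos₄₇ hκ p m
    positivity
  have hν : ((p * κ : ℕ) : ℚ) ≠ 0 := by
    have := Nat.mul_pos hp hκ
    positivity
  have hpD : ((p * powD p κ m : ℕ) : ℚ) ≠ 0 := by
    have := Nat.mul_pos hp (powD_pos₄₇ hκ p m)
    positivity
  rw [powWeights_one, powWeights_two hκ, inv_eq_one_div, inv_eq_one_div, inv_eq_one_div, mul_one_div,
    div_sub_div _ _ hν hD, div_eq_div_iff (mul_ne_zero hν hD) hpD]
  push_cast [powD]
  ring

/-- **The rate of the pin `y3 + x^p`**: `γ(y3)/p = 1/(p·D) = 1/(κp(mp+1))` — the same rate.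
(derived here) [cite: AbramovichTemkinWlodarczyk2024, §5.1 (weights of a centre)] -/
theorem powWeights_three_div (hκ : 1 ≤ κ) (p m : ℕ) :
    powWeights p κ m 3 / p = (((p * powD p κ m : ℕ) : ℚ))⁻¹ := by
  rw [powWeights_three hκ, Nat.cast_mul, mul_inv, div_eq_mul_inv, mul_comm]

/-- **`1/q < 1/(p·D)`**: the common rate of the two pins exceeds `1/q` exactly when `q/p > D`. (derived here;
the cell's `θ(Z) > 1/q`) [cite: Hauser2010, §D (p. 12)] -/
theorem inv_q_lt_inv_p_mul_powD (hp : 1 ≤ p) (hκ : 1 ≤ κ) (hq : powD p κ m < p ^ c) :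
    (((p ^ (c + 1) : ℕ) : ℚ))⁻¹ < (((p * powD p κ m : ℕ) : ℚ))⁻¹ := by
  have hpD : (0 : ℚ) < ((p * powD p κ m : ℕ) : ℚ) := by exact_mod_cast Nat.mul_pos hp (powD_pos₄₇ hκ p m)
  have hlt : ((p * powD p κ m : ℕ) : ℚ) < ((p ^ (c + 1) : ℕ) : ℚ) := by
    rw [pow_succ']
    exact_mod_cast Nat.mul_lt_mul_of_pos_left hq hp
  exact inv_strictAnti₀ hpD hlt

end PowFamily

/-! ## §2 Order, initial form, `δ`, `δ`-face and `τ` of `h` — characteristic-free -/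

section NewtonData

variable {p κ m c : ℕ}

/-- `in_ν` of a monomial (plumbing). [folklore] -/
private theorem homogeneousComponent_monomial₄₇ (n : ℕ) (e : Fin 4 →₀ ℕ) (a : k) :
    homogeneousComponent n (monomial e a) = if n = e.degree then monomial e a else 0 :=
  homogeneousComponent_of_mem ((mem_homogeneousSubmodule _ _).2 (isHomogeneous_monomial a rfl))

/-- `p·j ≤ m·p·j` (plumbing). [folklore] -/
private theorem p_mul_le₄₇ (hm : 1 ≤ m) (p j : ℕ) : p * j ≤ m * p * j := by
  rw [mul_assoc]
  exact Nat.le_mul_of_pos_left _ hm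

/-- **`ord h = κp`** (all weights `1`): the degrees of the monomials are `q/p > D` and `pi + (mp+1)j ≥ κp`
(`i + j = κ`). (derived here) [cite: AbramovichTemkinWlodarczyk2024, Lemma 5.2.10 (p. 1577)] -/
theorem monomialOrd_one_powH (hp : 2 ≤ p) (hκ : 1 ≤ κ) (hm : 1 ≤ m) (hq : powD p κ m < p ^ c) :
    monomialOrd (fun _ => 1) (powH k p κ m c) = ((p * κ : ℕ) : ℕ∞) := by
  classical
  have hp1 : 1 ≤ p := by omega
  have hν := Nat.mul_pos hp1 hκ
  apply le_antisymm
  · have h := monomialOrd_le_weight (fun _ : Fin 4 => 1) (F := powH k p κ m c) (d := expFin4 0 (p * κ) 0 0)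
      (by
        rw [mem_support_iff, coeff_powH, coeff_top_powFace, if_neg]
        · norm_num
        · rw [expFin4_eq_iff]; omega)
    rw [weight_expFin4] at h
    simpa using h
  · rw [le_monomialOrd_iff]
    intro d hd
    have hlt := (nu_lt_powD₄₇ p hκ hm).trans hq
    rcases Finset.mem_insert.1 (support_powH_subset p κ m c hd) with rfl | h
    · rw [weight_expFin4]
      simp only [mul_one, zero_add]
      exact hlt.le
    · obtain ⟨⟨i, j⟩, hij, rfl⟩ := Finset.mem_image.1 h
      simp only [Finset.mem_antidiagonal] at hij
      simp only [powExp, weight_expFin4, mul_one, zero_add]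
      have := p_mul_le₄₇ hm p j
      rw [← hij, mul_add]
      omega

/-- **`in_{κp} h = y1^{κp}`** (so `τ(in h) = 1`, block `S = {y1}`): among the monomials of `h` only `y1^{κp}`
(`j = 0`) has degree `κp`. (derived here) [cite: CossartJannsenSaito2020, Def. 1.26 / Lemma 1.27]
[cite: AbramovichTemkinWlodarczyk2024, Thm. 5.3.1 (2)] -/
theorem homogeneousComponent_powH (hκ : 1 ≤ κ) (hm : 1 ≤ m) (hq : powD p κ m < p ^ c) :
    homogeneousComponent (p * κ) (powH k p κ m c) = X 1 ^ (p * κ) := by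
  classical
  have hlt := (nu_lt_powD₄₇ p hκ hm).trans hq
  rw [powH, map_add, X3_pow_eq₄₇, homogeneousComponent_monomial₄₇, degree_expFin4, if_neg (by omega), zero_add,
    powFace_eq_sum, map_sum, Finset.sum_eq_single (κ, 0)]
  · rw [homogeneousComponent_monomial₄₇, powExp, degree_expFin4, if_pos (by simp)]
    simp only [mul_zero, pow_zero, Nat.choose_self, Nat.cast_one, one_mul, monomial_expFin4, mul_one]
  · rintro ⟨i, j⟩ hij hne
    simp only [Finset.mem_antidiagonal] at hij
    rw [homogeneousComponent_monomial₄₇, if_neg]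
    simp only [powExp, degree_expFin4]
    intro h
    apply hne
    have := p_mul_le₄₇ hm p j
    have hj : j = 0 := by
      rw [← hij, mul_add] at h
      omega
    subst hj
    rw [add_zero] at hij
    rw [hij]
  · intro h
    exact absurd (by simp) h

/-- The bottom vertex `y2^{mpκ} y3^κ` is in the support of `h` (plumbing). [folklore] -/
private theorem bottom_mem_support₄₇ (hp : 1 ≤ p) (hm : 1 ≤ m) (κ c : ℕ) :
    expFin4 0 0 (m * p * κ) κ ∈ (powH k p κ m c).support := by
  classical
  rw [mem_support_iff, coeff_powH, coeff_bottom_powFace,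
    if_neg (by simpa only [powExp, mul_zero] using X3pow_ne_powExp₄₇ hp hm c (0, κ))]
  rw [zero_add]
  exact pow_ne_zero _ (neg_ne_zero.2 one_ne_zero)

/-- **`δ(h; x, y2, y3; y1) = D/(κp) = (mp+1)/p`**: over the monomials with `y1`-degree `< κp` the ratio
`|A|/(κp − |B|)` is `(q/p)/(κp) > δ` at `y3^{q/p}` and `(mp+1)j/(pj) = δ` at EVERY other monomial of `ℓ^κ`
(`j ≥ 1`): all `κ + 1` monomials of `ℓ^κ` lie ON the `δ`-face. (derived here)
[cite: CossartJannsenSaito2020, Def. 8.1 (3) / Def. 8.2 (1) (pp. 117–118)] -/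
theorem hironakaDelta_powH (hp : 2 ≤ p) (hκ : 1 ≤ κ) (hm : 1 ≤ m) (hq : powD p κ m < p ^ c) :
    hironakaDelta ({1} : Finset (Fin 4)) (p * κ) (powH k p κ m c) =
      ((((powD p κ m : ℕ) : ℚ) / ((p * κ : ℕ) : ℚ) : ℚ) : WithTop ℚ) := by
  classical
  have hp1 : 1 ≤ p := by omega
  have hν : 0 < p * κ := Nat.mul_pos hp1 hκ
  apply le_antisymm
  · unfold hironakaDelta
    refine (Finset.inf_le (Finset.mem_filter.2 ⟨bottom_mem_support₄₇ hp1 hm κ c, ?_⟩)).trans (le_of_eq ?_)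
    · rw [blockDeg_one_expFin4]; exact hν
    · rw [coDeg_one_expFin4, blockDeg_one_expFin4, Nat.sub_zero, zero_add,
        show m * p * κ + κ = powD p κ m by unfold powD; ring]
  · rw [le_hironakaDelta_iff]
    intro d hd hb
    rcases Finset.mem_insert.1 (support_powH_subset p κ m c hd) with rfl | h
    · rw [coDeg_one_expFin4, blockDeg_one_expFin4, Nat.sub_zero, zero_add, zero_add]
      exact div_le_div_of_nonneg_right (by exact_mod_cast hq.le) (by positivity)
    · obtain ⟨⟨i, j⟩, hij, rfl⟩ := Finset.mem_image.1 h
      simp only [Finset.mem_antidiagonal] at hij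
      subst hij
      simp only [powExp, blockDeg_one_expFin4] at hb
      have hj : 0 < j := by
        rcases Nat.eq_zero_or_pos j with rfl | h0
        · simp at hb
        · exact h0
      simp only [powExp, coDeg_one_expFin4, blockDeg_one_expFin4, zero_add]
      rw [show p * (i + j) - p * i = p * j by rw [mul_add, Nat.add_sub_cancel_left],
        div_le_div_iff₀ (by positivity) (by positivity)]
      apply le_of_eq
      push_cast [powD]
      ring

/-- **`in_δ h = ℓ^κ`**: the `δ`-face of `Δ(h; u; y1)` carries exactly the `κ + 1` monomials of `ℓ^κ`; `y3^{q/p}`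
lies strictly above it (`q/p > D`). (derived here) [cite: CossartJannsenSaito2020, Def. 8.2 (4) (p. 118)] -/
theorem deltaInitial_powH (hp : 2 ≤ p) (hκ : 1 ≤ κ) (hm : 1 ≤ m) (hq : powD p κ m < p ^ c) :
    deltaInitial ({1} : Finset (Fin 4)) (p * κ) (((powD p κ m : ℕ) : ℚ) / ((p * κ : ℕ) : ℚ))
      (powH k p κ m c) = powFace k p κ m := by
  classical
  have hp1 : 1 ≤ p := by omega
  have hν : ((p * κ : ℕ) : ℚ) ≠ 0 := by
    have := Nat.mul_pos hp1 hκ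
    positivity
  -- the face predicate fails at `y3^{q/p}` …
  have P0 : ¬ (blockDeg ({1} : Finset (Fin 4)) (expFin4 0 0 0 (p ^ c)) ≤ p * κ ∧
      ((coDeg ({1} : Finset (Fin 4)) (expFin4 0 0 0 (p ^ c)) : ℚ) =
        ((powD p κ m : ℕ) : ℚ) / ((p * κ : ℕ) : ℚ) *
          (((p * κ - blockDeg ({1} : Finset (Fin 4)) (expFin4 0 0 0 (p ^ c)) : ℕ) : ℚ)))) := by
    rw [blockDeg_one_expFin4, coDeg_one_expFin4, Nat.sub_zero, div_mul_cancel₀ _ hν, zero_add, zero_add]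
    rintro ⟨-, h⟩
    have : p ^ c = powD p κ m := by exact_mod_cast h
    omega
  -- … and holds at every monomial of `ℓ^κ`
  have P1 : ∀ ij ∈ Finset.antidiagonal κ, blockDeg ({1} : Finset (Fin 4)) (powExp p m ij) ≤ p * κ ∧
      ((coDeg ({1} : Finset (Fin 4)) (powExp p m ij) : ℚ) =
        ((powD p κ m : ℕ) : ℚ) / ((p * κ : ℕ) : ℚ) *
          (((p * κ - blockDeg ({1} : Finset (Fin 4)) (powExp p m ij) : ℕ) : ℚ))) := by
    rintro ⟨i, j⟩ hij
    simp only [Finset.mem_antidiagonal] at hij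
    simp only [powExp, blockDeg_one_expFin4, coDeg_one_expFin4, zero_add]
    rw [← hij, show p * (i + j) - p * i = p * j by rw [mul_add, Nat.add_sub_cancel_left], div_mul_eq_mul_div,
      eq_div_iff (by rw [hij]; exact hν)]
    refine ⟨Nat.mul_le_mul_left p (Nat.le_add_right i j), ?_⟩
    push_cast [powD]
    ring
  ext d
  rw [coeff_deltaInitial]
  by_cases hd : d ∈ (powH k p κ m c).support
  · rcases Finset.mem_insert.1 (support_powH_subset p κ m c hd) with rfl | h
    · rw [if_neg P0, coeff_X3pow_powFace₄₇ hp1 hm]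
    · obtain ⟨ij, hij, rfl⟩ := Finset.mem_image.1 h
      rw [if_pos (P1 ij hij), coeff_powH, if_neg (X3pow_ne_powExp₄₇ hp1 hm c ij), zero_add]
  · have h0 : coeff d (powH k p κ m c) = 0 := by simpa [mem_support_iff] using hd
    rw [h0, ite_self]
    by_cases hd3 : expFin4 0 0 0 (p ^ c) = d
    · subst hd3
      exact (coeff_X3pow_powFace₄₇ hp1 hm κ c).symm
    · rw [coeff_powH, if_neg hd3, zero_add] at h0
      exact h0.symm

/-- `ℓ^κ ∈ k[y1, y2, y3]` (plumbing). [folklore] -/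
private theorem vars_powFace_subset₄₇ (p κ m : ℕ) : (powFace k p κ m).vars ⊆ {1, 2, 3} := by
  classical
  intro x hx
  rw [powFace] at hx
  have h1 := vars_pow _ _ hx
  rw [powLine] at h1
  rcases Finset.mem_union.1 (vars_sub_subset _ h1) with h | h
  · have := vars_pow _ _ h
    rw [vars_X] at this
    rw [Finset.mem_singleton.1 this]
    decide
  · rcases Finset.mem_union.1 (vars_mul _ _ h) with h | h
    · have := vars_pow _ _ h
      rw [vars_X] at this
      rw [Finset.mem_singleton.1 this]
      decide
    · rw [vars_X] at h
      rw [Finset.mem_singleton.1 h]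
      decide

/-- **`τ(ℓ^κ) = 3`: the `δ`-face form involves all of `y1, y2, y3` essentially** — its invariance space
(translations `w` with `ℓ^κ(Y + T w) = ℓ^κ(Y)` identically, `T` an indeterminate) is `w₁ = w₂ = w₃ = 0`:
at `Y = 0` one gets `ℓ(Tw)^κ = 0`, so `ℓ(Tw) = 0` in the domain `k[T]` and its `T^p`-coefficient `w₁^p`
vanishes; given `w₁ = 0`, at `Y = (0,0,0,1)`: `((T w₂)^{mp}(1 + T w₃))^κ = 0` forces `w₂ = 0`; given
`w₁ = w₂ = 0`, at `Y = (0,0,1,0)`: `(T w₃)^κ = 0` forces `w₃ = 0` (valid over every field, finite ones included).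
(derived here) [cite: CossartJannsenSaito2020, Def. 1.26 / Lemma 1.27 and Thm. 8.16 (p. 121) (`τ` of the `δ`-initial form)] -/
theorem hironakaTau_powFace (hp : 2 ≤ p) (hκ : 1 ≤ κ) (hm : 1 ≤ m) :
    hironakaTau k {powFace k p κ m} = 3 := by
  classical
  have hp0 : p ≠ 0 := by omega
  have hκ0 : κ ≠ 0 := by omega
  have hmp0 : m * p ≠ 0 := (Nat.mul_pos hm (by omega : 0 < p)).ne'
  have hpmp : p ≤ m * p := Nat.le_mul_of_pos_left p hm
  rw [show (3 : ℕ) = ({1, 2, 3} : Finset (Fin 4)).card by rfl]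
  refine hironakaTau_singleton_eq_card (vars_powFace_subset₄₇ p κ m) fun w hw => ?_
  -- the invariance identity at `k[T]`-valued points
  have key : ∀ (y : Fin 4 → Polynomial k),
      aeval (fun x => y x + Polynomial.C (w x) * Polynomial.X) (powFace k p κ m) =
        aeval y (powFace k p κ m) := fun y => by
    have h := aeval_algebra_eq_of_mem_invarianceSpace (A := Polynomial k) hw y Polynomial.X
    simpa only [Polynomial.algebraMap_eq] using h
  -- Step 1: `w 1 = 0`, from the point `y = 0`
  have hw1 : w 1 = 0 := by
    have h := key 0
    simp only [powFace, powLine, map_pow, map_sub, map_mul, aeval_X, Pi.zero_apply, zero_add,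
      zero_pow hp0, zero_pow hmp0, mul_zero, sub_zero, zero_pow hκ0] at h
    have h' := (pow_eq_zero_iff hκ0).1 h
    have h'' := congrArg (fun P => Polynomial.coeff P p) h'
    simp only [mul_pow, ← Polynomial.C_pow, Polynomial.coeff_sub, Polynomial.coeff_zero] at h''
    rw [Polynomial.coeff_C_mul_X_pow, if_pos rfl,
      show (Polynomial.C (w 2 ^ (m * p)) * Polynomial.X ^ (m * p) * (Polynomial.C (w 3) * Polynomial.X) :
          Polynomial k) = Polynomial.C (w 2 ^ (m * p) * w 3) * Polynomial.X ^ (m * p + 1) by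
        rw [Polynomial.C_mul, pow_succ]; ring,
      Polynomial.coeff_C_mul_X_pow, if_neg (by omega), sub_zero] at h''
    exact (pow_eq_zero_iff hp0).1 h''
  -- Step 2: `w 2 = 0`, from the point `y = (0,0,0,1)`
  have hw2 : w 2 = 0 := by
    have h := key (fun x => if x = 3 then 1 else 0)
    simp only [powFace, powLine, map_pow, map_sub, map_mul, aeval_X, hw1, map_zero, zero_mul,
      show (1 : Fin 4) ≠ 3 by decide, show (2 : Fin 4) ≠ 3 by decide, if_true, if_false,
      zero_add, add_zero, zero_pow hp0, zero_pow hmp0, mul_one, zero_sub, sub_zero, zero_pow hκ0] at h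
    have h' := (pow_eq_zero_iff hκ0).1 h
    rw [neg_eq_zero] at h'
    rcases mul_eq_zero.1 h' with h' | h'
    · rcases mul_eq_zero.1 ((pow_eq_zero_iff hmp0).1 h') with h3 | h3
      · exact Polynomial.C_eq_zero.1 h3
      · exact absurd h3 Polynomial.X_ne_zero
    · have := congrArg (Polynomial.eval 0) h'
      simp at this
  -- Step 3: `w 3 = 0`, from the point `y = (0,0,1,0)`
  have hw3 : w 3 = 0 := by
    have h := key (fun x => if x = 2 then 1 else 0)
    simp only [powFace, powLine, map_pow, map_sub, map_mul, aeval_X, hw1, hw2, map_zero, zero_mul,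
      show (1 : Fin 4) ≠ 2 by decide, show (3 : Fin 4) ≠ 2 by decide, if_true, if_false,
      zero_add, add_zero, zero_pow hp0, one_pow, one_mul, mul_zero, zero_sub, sub_zero, zero_pow hκ0] at h
    have h' := (pow_eq_zero_iff hκ0).1 h
    rw [neg_eq_zero] at h'
    rcases mul_eq_zero.1 h' with h3 | h3
    · exact Polynomial.C_eq_zero.1 h3
    · exact absurd h3 Polynomial.X_ne_zero
  intro x hx
  simp only [Finset.mem_insert, Finset.mem_singleton] at hx
  rcases hx with rfl | rfl | rfl
  exacts [hw1, hw2, hw3]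

end NewtonData

/-! ## §3 `max W(F) = (κp, D, D)` -/

section Max

variable {p κ m c : ℕ}

/-- **`max W(y3^{q/p} + ℓ^κ) = (κp, κ(mp+1), κ(mp+1))` over EVERY field** (`p ≥ 2` any integer, `κ, m ≥ 1`,
`q/p = p^c > κ(mp+1)`): order `κp` with `in = y1^{κp}`, `δ = (mp+1)/p ∉ ℕ`, `τ(in_δ) = τ(ℓ^κ) = 3`, and the
identity centre with `γ = (0; 1/(κp), 1/D, 1/D)` attains it. (derived here — the `(ν, M, M)` pattern; the cell's
value `C_q(h) = c_κ`, here for centres presented by polynomial coordinate changes)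
[cite: CossartJannsenSaito2020, Thm. 8.16 (p. 121), Thm. 8.22 (a) (p. 124)]
[cite: AbramovichTemkinWlodarczyk2024, Thm. 5.3.1 (2)–(3) (p. 1578)] -/
theorem isMaxInv_powH (hp : 2 ≤ p) (hκ : 1 ≤ κ) (hm : 1 ≤ m) (hq : powD p κ m < p ^ c) :
    IsMaxInv (admissibleInvariants (powH k p κ m c))
      [((p * κ : ℕ) : ℚ), ((powD p κ m : ℕ) : ℚ), ((powD p κ m : ℕ) : ℚ)] :=
  isMaxInv_triple_of_forall_natCast_ne (monomialOrd_one_powH hp hκ hm hq) (homogeneousComponent_powH hκ hm hq)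
    (Nat.mul_pos (by omega) hκ) (by exact_mod_cast nu_lt_powD₄₇ p hκ hm)
    (hironakaDelta_powH hp hκ hm hq) (natCast_ne_powDelta₄₇ hp hκ m)
    (by rw [deltaInitial_powH hp hκ hm hq, hironakaTau_powFace hp hκ hm])
    (powH_mem_admissibleInvariants (by omega) hκ hm hq)

/-- **THE POWER FAMILY: `max W(x^q + y3^{q/p} + (y1^p − y2^{mp} y3)^κ) = (κp, κ(mp+1), κ(mp+1))`** in
characteristic `p`, for every prime `p`, EVERY `κ ≥ 1`, `m ≥ 1`, `q = p^{c+1} > κp(mp+1)`, over admissible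
centres presented by polynomial coordinate changes — attained by the NON-SPLIT bent centre
`(y1 + x y2^m, y2, y3 + x^p; 1/(κp), 1/D, 1/D; x free)`, which is NOT `T`-tight (`not_isTTight_pow`) and whose two
pins have rate `1/(κp(mp+1)) > 1/q`.  (derived here; the cell's THEOREM F^κ (a) in the polynomial model; that NO
maximal centre is `T`-tight when `κ ∉ p^ℕ` — THEOREM F^κ (b) — is NOT typed here.)  Instrument value, not a
resolution statement. [cite: AbramovichTemkinWlodarczyk2024, Thm. 5.3.1 (2)–(3) (p. 1578)]
[cite: Hauser2010, §C (p. 9), §D (p. 12) (wild purely inseparable singularities; kangaroo points)]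
[cite: CossartJannsenSaito2020, Thm. 8.16 (p. 121)] -/
theorem isMaxInv_powF [hp : Fact p.Prime] [CharP k p] (hκ : 1 ≤ κ) (hm : 1 ≤ m)
    (hq : κ * (m * p + 1) < p ^ c) :
    IsMaxInv (admissibleInvariants (powF k p κ m c))
      [((p * κ : ℕ) : ℚ), ((κ * (m * p + 1) : ℕ) : ℚ), ((κ * (m * p + 1) : ℕ) : ℚ)] := by
  rw [admissibleInvariants_powF]
  exact isMaxInv_powH hp.out.two_le hκ hm hq

/-- **The smallest instance with `κ` not a power of `p`**, `(p, κ, m, q) = (3, 2, 1, 27)`: over any field of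
characteristic `3`, `max W(x^27 + y3^9 + (y1^3 − y2^3 y3)^2) = (6, 8, 8)`, attained by the bent centre
`(y1 + x y2, y2, y3 + x^3; 1/6, 1/8, 1/8)` of rate `1/24 > 1/27`. (derived here; the cell's THEOREM F^κ example,
engine-1 gen 31) [cite: AbramovichTemkinWlodarczyk2024, Thm. 5.3.1 (2)–(3) (p. 1578)] [cite: Hauser2010, §D (p. 12)] -/
theorem isMaxInv_pow_3_2_1_27 (k : Type*) [Field k] [CharP k 3] :
    IsMaxInv (admissibleInvariants
      (X 0 ^ 27 + (X 3 ^ 9 + (X 1 ^ 3 - X 2 ^ 3 * X 3) ^ 2) : MvPolynomial (Fin 4) k)) [(6 : ℚ), 8, 8] := by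
  haveI : Fact (Nat.Prime 3) := ⟨Nat.prime_three⟩
  have h := isMaxInv_powF (k := k) (p := 3) (κ := 2) (m := 1) (c := 2) (by norm_num) le_rfl (by norm_num)
  simp only [powF, powH, powFace, powLine] at h
  norm_num at h
  exact h

/-- The smallest instance in characteristic `2` with `κ` not a power of `2`, `(p, κ, m, q) = (2, 3, 1, 32)`:
`max W(x^32 + y3^16 + (y1^2 − y2^2 y3)^3) = (6, 9, 9)`, attained by `(y1 + x y2, y2, y3 + x^2; 1/6, 1/9, 1/9)`
of rate `1/18 > 1/32`. (derived here) [cite: AbramovichTemkinWlodarczyk2024, Thm. 5.3.1 (2)–(3) (p. 1578)]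
[cite: Hauser2010, §D (p. 12)] -/
theorem isMaxInv_pow_2_3_1_32 (k : Type*) [Field k] [CharP k 2] :
    IsMaxInv (admissibleInvariants
      (X 0 ^ 32 + (X 3 ^ 16 + (X 1 ^ 2 - X 2 ^ 2 * X 3) ^ 3) : MvPolynomial (Fin 4) k)) [(6 : ℚ), 9, 9] := by
  haveI : Fact (Nat.Prime 2) := ⟨Nat.prime_two⟩
  have h := isMaxInv_powF (k := k) (p := 2) (κ := 3) (m := 1) (c := 4) (by norm_num) le_rfl (by norm_num)
  simp only [powF, powH, powFace, powLine] at h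
  norm_num at h
  exact h

end Max

/-! ## §4 The case `κ = p^s`: a SPLIT, `T`-tight centre with the same invariant -/

section Split

variable {p m : ℕ}

variable (k) in
/-- The split coordinate change `Ψ_T : y1 ↦ y1 + x^e` (all other variables fixed). (the cell's `T`-tight centre
`Z_T`, engine-1 gen 31) [cite: CossartJannsenSaito2020, Def. 8.2 / Thm. 8.16 (p. 121) (coordinate changes `y ↦ y + q(u)`)] -/
def powTightShear (e : ℕ) : MvPolynomial (Fin 4) k ≃ₐ[k] MvPolynomial (Fin 4) k := addPolyShear 1 (X 0 ^ e)

/-- `y1 ∉ vars (x^e)` (plumbing). [folklore] -/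
private theorem one_notMem_vars_X0_pow₄₇ (e : ℕ) : (1 : Fin 4) ∉ (X 0 ^ e : MvPolynomial (Fin 4) k).vars := by
  intro h
  have := vars_pow _ _ h
  rw [vars_X] at this
  exact absurd (Finset.mem_singleton.1 this) (by decide)

/-- `Ψ_T⁻¹(y1) = y1 − x^e`. (derived here) [cite: CossartJannsenSaito2020, Def. 8.2 (p. 118)] -/
theorem powTightShear_symm_X_one (e : ℕ) : (powTightShear k e).symm (X 1) = X 1 - X 0 ^ e := by
  rw [powTightShear]
  simp [addPolyShear, sub_eq_add_neg, killVar_eq_self_of_notMem (one_notMem_vars_X0_pow₄₇ (k := k) e)]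

/-- `Ψ_T⁻¹` fixes `x, y2, y3`. (derived here) [cite: CossartJannsenSaito2020, Def. 8.2 (p. 118)] -/
theorem powTightShear_symm_X_of_ne (e : ℕ) {x : Fin 4} (hx : x ≠ 1) : (powTightShear k e).symm (X x) = X x := by
  rw [powTightShear]
  simp [addPolyShear, hx]

/-- `Ψ_T` fixes the origin (`e ≥ 1`). (derived here) [cite: AbramovichTemkinWlodarczyk2024, Lemma 5.2.10 (p. 1577)] -/
theorem constantCoeff_powTightShear_X {e : ℕ} (he : 1 ≤ e) (i : Fin 4) :
    constantCoeff (powTightShear k e (X i)) = 0 :=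
  constantCoeff_addPolyShear_X 1 (by rw [map_pow, constantCoeff_X, zero_pow (by omega)]) i

/-- **For `κ = p^s` the split change also carries `F` to `h`**: with `q = p^{s+t+1}` and `e = p^t`,
`Ψ_T⁻¹ F = x^q + y3^{q/p} + ((y1 − x^{p^t})^p − y2^{mp} y3)^{p^s} = y3^{q/p} + ℓ^{p^s}` in characteristic `p`,
since `(ℓ − x^{p^{t+1}})^{p^s} = ℓ^{p^s} − x^q`. (derived here; the cell's THEOREM F^κ, case `κ = p^s`)
[cite: CossartJannsenSaito2020, Thm. 8.16 (p. 121)] [cite: Hauser2010, §C (p. 9)] -/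
theorem powTightShear_symm_powF [hp : Fact p.Prime] [CharP k p] (s t m : ℕ) :
    (powTightShear k (p ^ t)).symm (powF k p (p ^ s) m (s + t)) = powH k p (p ^ s) m (s + t) := by
  simp only [powF, powH, powFace, powLine, map_add, map_sub, map_mul, map_pow, powTightShear_symm_X_one,
    powTightShear_symm_X_of_ne _ (show (0 : Fin 4) ≠ 1 by decide),
    powTightShear_symm_X_of_ne _ (show (2 : Fin 4) ≠ 1 by decide),
    powTightShear_symm_X_of_ne _ (show (3 : Fin 4) ≠ 1 by decide)]
  rw [sub_pow_char (p := p) (X 1), ← pow_mul, ← pow_succ, sub_right_comm, sub_pow_char_pow (p := p), ← pow_mul,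
    ← pow_add, show t + 1 + s = s + t + 1 by ring]
  ring

/-- **The split centre `(Ψ_T, γ)` is a centre for `F`** when `κ = p^s`, `q/p = p^{s+t} > D`. (derived here)
[cite: AbramovichTemkinWlodarczyk2024, Thm. 5.3.1 (2) (p. 1578)] -/
theorem isCentreFor_powTight [hp : Fact p.Prime] [CharP k p] {s t : ℕ}
    (hq : p ^ s * (m * p + 1) < p ^ (s + t)) :
    IsCentreFor (powF k p (p ^ s) m (s + t)) (powTightShear k (p ^ t)) (powWeights p (p ^ s) m) := by
  refine ⟨constantCoeff_powTightShear_X (Nat.one_le_pow t p hp.out.pos), powWeights_nonneg p (p ^ s) m, ?_⟩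
  rw [powTightShear_symm_powF]
  exact isAdmissibleFor_powH hp.out.one_lt.le (Nat.one_le_pow s p hp.out.pos) hq

/-- `v_γ(X_x^n) = n γ_x` (plumbing). [folklore] -/
private theorem monomialValuation_single₄₇ (γ : Fin 4 → ℚ) (x : Fin 4) (n : ℕ) :
    monomialValuation γ (Finsupp.single x n) = n * γ x := by
  rw [monomialValuation, Finsupp.sum_single_index (by simp)]

/-- **The split centre IS `T`-tight**: the only `x`-term of an old parameter is `−x^{p^t}` in `Ψ_T⁻¹(y1) =
y1 − x^{p^t}`, of split value `p^t/q = 1/p^{s+1} = γ(y1)`. (derived here; the cell's `T`-tight centre `Z_T` for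
`κ = p^s`, engine-1 gen 31) [cite: CossartJannsenSaito2020, Thm. 8.16 (p. 121)] -/
theorem isTTight_powTight (hp : 2 ≤ p) (s t m : ℕ) :
    IsTTight (p ^ (s + t + 1)) 0 (powTightShear k (p ^ t)) (powWeights p (p ^ s) m) := by
  classical
  intro i d hd hd0
  by_cases hi : i = 1
  · subst hi
    rw [powTightShear_symm_X_one] at hd
    rcases Finset.mem_union.1 (support_sub _ _ _ hd) with h | h
    · rw [support_X, Finset.mem_singleton] at h
      subst h
      simp at hd0
    · rw [support_X_pow, Finset.mem_singleton] at h
      subst h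
      rw [powWeights_one, monomialValuation_single₄₇, Function.update_self]
      apply le_of_eq
      rw [one_div, ← div_eq_mul_inv, inv_eq_one_div, div_eq_div_iff (by positivity) (by positivity)]
      push_cast
      ring
  · rw [powTightShear_symm_X_of_ne _ hi, support_X, Finset.mem_singleton] at hd
    subst hd
    rw [Finsupp.single_apply] at hd0
    split_ifs at hd0 with h0
    · subst h0
      rw [powWeights_zero]
      refine monomialValuation_nonneg _ (fun x => ?_) _
      rcases eq_or_ne x 0 with rfl | hx
      · rw [Function.update_self]; positivity
      · rw [Function.update_of_ne hx]; exact powWeights_nonneg p (p ^ s) m x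
    · exact absurd hd0 (lt_irrefl 0)

/-- Hence for `κ = p^s` the maximal invariant `(p^{s+1}, D, D)` of `F` is attained BOTH by the non-split bent
centre and by the split `T`-tight centre `(y1 + x^{p^t}, y2, y3; 1/p^{s+1}, 1/D, 1/D)`. (derived here)
[cite: AbramovichTemkinWlodarczyk2024, Thm. 5.3.1 (2)–(3) (p. 1578)] -/
theorem isMaxInv_powF_tight [hp : Fact p.Prime] [CharP k p] {s t : ℕ} (hm : 1 ≤ m)
    (hq : p ^ s * (m * p + 1) < p ^ (s + t)) :
    IsMaxInv (admissibleInvariants (powF k p (p ^ s) m (s + t))) (exps (powWeights p (p ^ s) m)) ∧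
      IsCentreFor (powF k p (p ^ s) m (s + t)) (powTightShear k (p ^ t)) (powWeights p (p ^ s) m) ∧
      IsTTight (p ^ (s + t + 1)) 0 (powTightShear k (p ^ t)) (powWeights p (p ^ s) m) := by
  refine ⟨?_, isCentreFor_powTight hq, isTTight_powTight hp.out.two_le s t m⟩
  rw [exps_powWeights hp.out.one_lt.le (Nat.one_le_pow s p hp.out.pos) hm]
  exact isMaxInv_powF (Nat.one_le_pow s p hp.out.pos) hm hq

end Split

end Literature.AlgebraicGeometry.Resolution.WeightedBlowup
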